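import Literature.NumberTheory.IwasawaTheory.ClassicalMuVanishesKurodaTower
import HarnessLib

set_option autoImplicit false

/-!
# Relative Klein (Kuroda) descent inside a Galois extension: `μ(L^N) = 0` from `μ = 0` of `L^{N⟨x⟩}`, `L^{N⟨y⟩}`,
# `L^{N⟨xy⟩}`, `L^{N⟨x,y⟩}` when `x, y` normalise `N` and are commuting involutions modulo `N`

Topic `NumberTheory/IwasawaTheory` (namespace = path).  THEOREM-ONLY file (no definition, no named fact, no `sorry`); literature
seat `bsd-potss-conjA-anchor` g11 (supports stmt-BirchSwinnertonDyer-19386 / 19413; closes nothing).  The fact-free Klein descent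
`classicalMuVanishes_of_isCyclotomic_of_biquadratic` (Kuroda's relation at every layer of the cyclotomic tower, [Lemmermeyer1994] §1)
is stated for the TOP of a Galois extension `L/F`.  Multi-level descents (e.g. the split Cartan normaliser `N_s(5)` at `p = 5`, whose
Klein fours all meet a non-normal involution) need it for an INTERMEDIATE Galois piece `L^N / L^{H'}`, `H' = ⟨N, x, y⟩`, `H'/N ≅ V₄`:

* `classicalMuVanishes_of_isCyclotomic_of_relative_biquadratic` — `L/ℚ` finite Galois, `p` odd, `p ∤ [L:ℚ]`, `N ≤ Gal(L/ℚ)`, `x, y` in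
  the normaliser of `N` with `x², y², [x,y] ∈ N`: if `μ = 0` holds for every cyclotomic `ℤ_p`-extension of `L^{N ⊔ ⟨x⟩}`, `L^{N ⊔ ⟨y⟩}`,
  `L^{N ⊔ ⟨xy⟩}` and `L^{N ⊔ ⟨x⟩ ⊔ ⟨y⟩}`, then for every cyclotomic `ℤ_p`-extension of `L^N`.  Proof: base change to `K = L^{H'}`
  (`Gal(L/K) ≅ H'`, `IntermediateField.subgroupEquivAlgEquiv`), pass to the quotient `Gal(L^N/K) = H'/N` (`restrictNormalHom`), apply the
  biquadratic theorem over `K`, and hand the five fields back as `ℚ`-subfields of `L` along the identity of `L` (`AlgEquiv.ofRingEquiv`).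

References: [Lemmermeyer1994, §1]; [Washington1997, §13.1]; [MilneFT2022, Ch. 3 (fundamental theorem, `Gal(L^N/L^{H'}) = H'/N`)].
-/

noncomputable section

open scoped NumberField

open Field IntermediateField Literature.NumberTheory.EllipticCurves

namespace Literature.NumberTheory.IwasawaTheory

variable {p : ℕ} [Fact p.Prime]

omit [Fact p.Prime] in
/-- `p ∤ [E : ℚ]` for an intermediate field `E` of `L/ℚ` when `p ∤ [L : ℚ]`. [folklore] -/
private theorem not_dvd_finrank_intermediateField₃ {L : Type} [Field L] [NumberField L]
    (hp : ¬ p ∣ Module.finrank ℚ L) (E : IntermediateField ℚ L) : ¬ p ∣ Module.finrank ℚ ↥E := fun h =>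
  hp (h.trans (Dvd.intro _ (Module.finrank_mul_finrank ℚ ↥E L)))

omit [Fact p.Prime] in
/-- `⟨g⟩` fixes `a` iff `g` does. [folklore] -/
private theorem forall_mem_zpowers_apply_eq_iff {F' E : Type} [CommSemiring F'] [Semiring E] [Algebra F' E] (g : E ≃ₐ[F'] E) (a : E) :
    (∀ f ∈ Subgroup.zpowers g, f a = a) ↔ g a = a :=
  ⟨fun h => h g (Subgroup.mem_zpowers g), fun h _ hf =>
    (Subgroup.zpowers_le (H := MulAction.stabilizer (E ≃ₐ[F'] E) a)).mpr (MulAction.mem_stabilizer_iff.mpr h) hf⟩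

omit [Fact p.Prime] in
/-- `A ⊔ B` fixes `a` iff `A` and `B` do. [folklore] -/
private theorem forall_mem_sup_apply_eq_iff {F' E : Type} [CommSemiring F'] [Semiring E] [Algebra F' E] (A B : Subgroup (E ≃ₐ[F'] E))
    (a : E) : (∀ f ∈ A ⊔ B, f a = a) ↔ (∀ f ∈ A, f a = a) ∧ ∀ f ∈ B, f a = a :=
  ⟨fun h => ⟨fun f hf => h f (Subgroup.mem_sup_left hf), fun f hf => h f (Subgroup.mem_sup_right hf)⟩, fun h _ hf =>
    (sup_le (fun f hf => MulAction.mem_stabilizer_iff.mpr (h.1 f hf)) (fun f hf => MulAction.mem_stabilizer_iff.mpr (h.2 f hf)) :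
      A ⊔ B ≤ MulAction.stabilizer (E ≃ₐ[F'] E) a) hf⟩

omit [Fact p.Prime] in
/-- `⟨z, b⟩` fixes `a` iff `z` and `b` do. [folklore] -/
private theorem forall_mem_closure_pair_apply_eq_iff {F' E : Type} [CommSemiring F'] [Semiring E] [Algebra F' E] (z b : E ≃ₐ[F'] E)
    (a : E) : (∀ f ∈ Subgroup.closure ({z, b} : Set (E ≃ₐ[F'] E)), f a = a) ↔ z a = a ∧ b a = a :=
  ⟨fun h => ⟨h z (Subgroup.subset_closure (Set.mem_insert z {b})),
    h b (Subgroup.subset_closure (Set.mem_insert_of_mem z (Set.mem_singleton b)))⟩, fun h _ hf =>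
    ((Subgroup.closure_le (MulAction.stabilizer (E ≃ₐ[F'] E) a)).mpr
      (Set.insert_subset (MulAction.mem_stabilizer_iff.mpr h.1)
        (Set.singleton_subset_iff.mpr (MulAction.mem_stabilizer_iff.mpr h.2)))) hf⟩

/-- Transport of «`μ = 0` for every cyclotomic `ℤ_p`-extension» from a `ℚ`-subfield `L^S` of `L` to a fixed field inside
`E₁ = L^{N₁}` (over the base `K`) with the same elements. [folklore] -/
private theorem forall_classicalMuVanishes_fixedField_of_mem_iff {L : Type} [Field L] [NumberField L]
    (hp : ¬ p ∣ Module.finrank ℚ L) (K : IntermediateField ℚ L) (N₁ : Subgroup (L ≃ₐ[↥K] L))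
    (S' : Subgroup (↥(fixedField N₁) ≃ₐ[↥K] ↥(fixedField N₁))) (S : Subgroup (L ≃ₐ[ℚ] L))
    (h : ∀ a : ↥(fixedField N₁), a ∈ fixedField S' ↔ (a : L) ∈ fixedField S)
    (h' : ∀ l : L, l ∈ fixedField S → l ∈ fixedField N₁)
    (hμ : ∀ κE : ZpExtension ↥(fixedField S) p, κE.IsCyclotomic → ClassicalMuVanishes κE) :
    ∀ κE : ZpExtension ↥(fixedField S') p, κE.IsCyclotomic → ClassicalMuVanishes κE := by
  let e : ↥(fixedField S) ≃+* ↥(fixedField S') :=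
    { toFun := fun l => ⟨⟨(l : L), h' _ l.2⟩, (h _).mpr l.2⟩
      invFun := fun a => ⟨((a : ↥(fixedField N₁)) : L), (h _).mp a.2⟩
      left_inv := fun _ => rfl
      right_inv := fun _ => rfl
      map_mul' := fun _ _ => rfl
      map_add' := fun _ _ => rfl }
  have he : ∀ q : ℚ, e (algebraMap ℚ ↥(fixedField S) q) = algebraMap ℚ ↥(fixedField S') q := fun q => by
    rw [eq_ratCast, eq_ratCast, map_ratCast]
  exact forall_classicalMuVanishes_of_algEquiv (F := ℚ) (AlgEquiv.ofRingEquiv (f := e) he)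
    (not_dvd_finrank_intermediateField₃ hp _) hμ

/-- Transport of «`μ = 0` for every cyclotomic `ℤ_p`-extension» from `E₁ = L^{N₁}` (over the base `K`) to a `ℚ`-subfield of
`L` with the same elements. [folklore] -/
private theorem forall_classicalMuVanishes_of_mem_fixedField_iff {L : Type} [Field L] [NumberField L]
    (hp : ¬ p ∣ Module.finrank ℚ L) (K : IntermediateField ℚ L) (N₁ : Subgroup (L ≃ₐ[↥K] L))
    (M : IntermediateField ℚ L) (h : ∀ l : L, l ∈ fixedField N₁ ↔ l ∈ M)
    (hμ : ∀ κE : ZpExtension ↥(fixedField N₁) p, κE.IsCyclotomic → ClassicalMuVanishes κE) :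
    ∀ κE : ZpExtension ↥M p, κE.IsCyclotomic → ClassicalMuVanishes κE := by
  let e : ↥(fixedField N₁) ≃+* ↥M :=
    { toFun := fun a => ⟨(a : L), (h _).mp a.2⟩
      invFun := fun l => ⟨(l : L), (h _).mpr l.2⟩
      left_inv := fun _ => rfl
      right_inv := fun _ => rfl
      map_mul' := fun _ _ => rfl
      map_add' := fun _ _ => rfl }
  have he : ∀ q : ℚ, e (algebraMap ℚ ↥(fixedField N₁) q) = algebraMap ℚ ↥M q := fun q => by
    rw [eq_ratCast, eq_ratCast, map_ratCast]
  have hpE : ¬ p ∣ Module.finrank ℚ ↥(fixedField N₁) := by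
    rw [(AlgEquiv.ofRingEquiv (f := e) he).toLinearEquiv.finrank_eq]
    exact not_dvd_finrank_intermediateField₃ hp _
  exact forall_classicalMuVanishes_of_algEquiv (F := ℚ) (AlgEquiv.ofRingEquiv (f := e) he) hpE hμ

set_option maxHeartbeats 1600000 in
/-- **Relative Klein descent (fact-free).**  `L/ℚ` finite Galois, `p` odd with `p ∤ [L : ℚ]`; `N ≤ Gal(L/ℚ)` and `x, y ∈ N_G(N)` with
`x², y², [x, y] ∈ N` (so `H' = ⟨N, x, y⟩ ⊵ N` with `H'/N` a Klein four-group or smaller).  If `μ = 0` holds (growth form) for every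
cyclotomic `ℤ_p`-extension of each of `L^{N⟨x⟩}`, `L^{N⟨y⟩}`, `L^{N⟨xy⟩}`, `L^{H'}`, then for every cyclotomic `ℤ_p`-extension of `L^N`:
Kuroda's relation ([Lemmermeyer1994] §1) for the Galois extension `L^N / L^{H'}` at every layer of the cyclotomic tower
(`classicalMuVanishes_of_isCyclotomic_of_biquadratic` over the base `L^{H'}`); no growth theorem, no named fact.
[cite: Lemmermeyer1994, §1 (Kuroda's class number formula, odd part)] [cite: MilneFT2022, Ch. 3 (fundamental theorem of Galois theory)]
[cite: Washington1997, §13.1] -/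
theorem classicalMuVanishes_of_isCyclotomic_of_relative_biquadratic (hp2 : p ≠ 2)
    (L : Type) [Field L] [NumberField L] [IsGalois ℚ L] (hp : ¬ p ∣ Module.finrank ℚ L)
    (N : Subgroup (L ≃ₐ[ℚ] L)) {x y : L ≃ₐ[ℚ] L} (hx : x ∈ Subgroup.normalizer (N : Set (L ≃ₐ[ℚ] L)))
    (hy : y ∈ Subgroup.normalizer (N : Set (L ≃ₐ[ℚ] L)))
    (hxx : x * x ∈ N) (hyy : y * y ∈ N) (hxy : x * y * x⁻¹ * y⁻¹ ∈ N)
    (hμX : ∀ κE : ZpExtension ↥(fixedField (N ⊔ Subgroup.zpowers x)) p, κE.IsCyclotomic → ClassicalMuVanishes κE)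
    (hμY : ∀ κE : ZpExtension ↥(fixedField (N ⊔ Subgroup.zpowers y)) p, κE.IsCyclotomic → ClassicalMuVanishes κE)
    (hμXY : ∀ κE : ZpExtension ↥(fixedField (N ⊔ Subgroup.zpowers (x * y))) p, κE.IsCyclotomic → ClassicalMuVanishes κE)
    (hμC : ∀ κE : ZpExtension ↥(fixedField (N ⊔ Subgroup.zpowers x ⊔ Subgroup.zpowers y)) p,
      κE.IsCyclotomic → ClassicalMuVanishes κE)
    (κN : ZpExtension ↥(fixedField N) p) (hκN : κN.IsCyclotomic) : ClassicalMuVanishes κN := by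
  -- the group `H' = ⟨N, x, y⟩`, which normalises `N`, and the base `K = L^{H'}`
  obtain ⟨H', hH'⟩ : ∃ H' : Subgroup (L ≃ₐ[ℚ] L), H' = N ⊔ Subgroup.zpowers x ⊔ Subgroup.zpowers y := ⟨_, rfl⟩
  have hNH' : N ≤ H' := hH' ▸ le_sup_left.trans le_sup_left
  have hxH' : x ∈ H' := hH' ▸ Subgroup.mem_sup_left (Subgroup.mem_sup_right (Subgroup.mem_zpowers x))
  have hyH' : y ∈ H' := hH' ▸ Subgroup.mem_sup_right (Subgroup.mem_zpowers y)
  have hH'n : H' ≤ Subgroup.normalizer (N : Set (L ≃ₐ[ℚ] L)) := by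
    rw [hH']
    exact sup_le (sup_le Subgroup.le_normalizer ((Subgroup.zpowers_le).mpr hx)) ((Subgroup.zpowers_le).mpr hy)
  obtain ⟨K, hK⟩ : ∃ K : IntermediateField ℚ L, K = fixedField H' := ⟨_, rfl⟩
  -- `Gal(L/K) ≅ H'`
  have hKfix : K.fixingSubgroup = H' := by rw [hK, IntermediateField.fixingSubgroup_fixedField]
  obtain ⟨ψ, hψdef⟩ : ∃ ψ : ↥K.fixingSubgroup ≃* (L ≃ₐ[↥K] L), ψ = IntermediateField.fixingSubgroupEquiv K := ⟨_, rfl⟩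
  have hψ : ∀ (h : ↥K.fixingSubgroup) (l : L), ψ h l = (h : L ≃ₐ[ℚ] L) l := fun _ _ => by rw [hψdef]; rfl
  have hψ' : ∀ (g : L ≃ₐ[↥K] L) (l : L), ((ψ.symm g : ↥K.fixingSubgroup) : L ≃ₐ[ℚ] L) l = g l := fun g l => by
    rw [← hψ, MulEquiv.apply_symm_apply]
  have hxK : x ∈ K.fixingSubgroup := hKfix ▸ hxH'
  have hyK : y ∈ K.fixingSubgroup := hKfix ▸ hyH'
  have hNK : N ≤ K.fixingSubgroup := hKfix ▸ hNH'
  -- `N₁ ≅ N` inside `Gal(L/K)`, a normal subgroup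
  haveI : (N.subgroupOf K.fixingSubgroup).Normal :=
    (Subgroup.normal_subgroupOf_iff_le_normalizer hNK).mpr (hKfix ▸ hH'n)
  obtain ⟨N₁, hN₁def⟩ : ∃ N₁ : Subgroup (L ≃ₐ[↥K] L), N₁ = (N.subgroupOf K.fixingSubgroup).comap ψ.symm.toMonoidHom :=
    ⟨_, rfl⟩
  have hmemN₁ : ∀ g : L ≃ₐ[↥K] L, g ∈ N₁ ↔ ((ψ.symm g : ↥K.fixingSubgroup) : L ≃ₐ[ℚ] L) ∈ N := fun _ => by
    rw [hN₁def]; rfl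
  haveI hN₁ : N₁.Normal := hN₁def ▸ Subgroup.Normal.comap inferInstance _
  -- membership in `E₁ = L^{N₁}` (`= L^N` as a set)
  have hmemE : ∀ l : L, l ∈ (fixedField N₁ : IntermediateField ↥K L) ↔ ∀ n ∈ N, n l = l := by
    intro l
    rw [IntermediateField.mem_fixedField_iff]
    constructor
    · intro h n hn
      have h1 := h (ψ ⟨n, hNK hn⟩) (by rw [hmemN₁, MulEquiv.symm_apply_apply]; exact hn)
      rwa [hψ] at h1
    · intro h g hg
      rw [← hψ' g l]
      exact h _ ((hmemN₁ g).mp hg)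
  haveI : IsGalois ↥K ↥(fixedField N₁) := IsGalois.of_fixedField_normal_subgroup N₁
  -- the quotient map `Gal(L/K) → Gal(E₁/K)` and its kernel
  have hker : ∀ g : L ≃ₐ[↥K] L, AlgEquiv.restrictNormalHom ↥(fixedField N₁) g = 1 ↔ g ∈ N₁ := by
    intro g
    have h1 := IntermediateField.restrictNormalHom_ker (fixedField N₁ : IntermediateField ↥K L)
    rw [IntermediateField.fixingSubgroup_fixedField] at h1
    rw [← MonoidHom.mem_ker, h1]
  have hres : ∀ (g : L ≃ₐ[↥K] L) (a : ↥(fixedField N₁)),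
      ((AlgEquiv.restrictNormalHom ↥(fixedField N₁) g a : ↥(fixedField N₁)) : L) = g (a : L) :=
    fun g a => AlgEquiv.restrictNormal_commutes g ↥(fixedField N₁) a
  -- the two commuting involutions `z = x̄`, `b = ȳ` of `Gal(E₁/K)`
  obtain ⟨z, hz⟩ : ∃ z, z = AlgEquiv.restrictNormalHom ↥(fixedField N₁) (ψ ⟨x, hxK⟩) := ⟨_, rfl⟩
  obtain ⟨b, hb⟩ : ∃ b, b = AlgEquiv.restrictNormalHom ↥(fixedField N₁) (ψ ⟨y, hyK⟩) := ⟨_, rfl⟩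
  have hzL : ∀ a : ↥(fixedField N₁), ((z a : ↥(fixedField N₁)) : L) = x (a : L) := fun a => by rw [hz, hres, hψ]
  have hbL : ∀ a : ↥(fixedField N₁), ((b a : ↥(fixedField N₁)) : L) = y (a : L) := fun a => by rw [hb, hres, hψ]
  have hzz : z * z = 1 := by
    rw [hz, ← map_mul, ← map_mul, hker, hmemN₁, MulEquiv.symm_apply_apply]
    exact hxx
  have hbb : b * b = 1 := by
    rw [hb, ← map_mul, ← map_mul, hker, hmemN₁, MulEquiv.symm_apply_apply]
    exact hyy
  have hzb : z * b = b * z := by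
    have h1 : AlgEquiv.restrictNormalHom ↥(fixedField N₁)
        (ψ ⟨x, hxK⟩ * ψ ⟨y, hyK⟩ * (ψ ⟨x, hxK⟩)⁻¹ * (ψ ⟨y, hyK⟩)⁻¹) = 1 := by
      rw [hker, hmemN₁, ← map_inv, ← map_inv, ← map_mul, ← map_mul, ← map_mul, MulEquiv.symm_apply_apply]
      exact hxy
    rw [map_mul, map_mul, map_mul, map_inv, map_inv, mul_inv_eq_one, mul_inv_eq_iff_eq_mul, ← hz, ← hb] at h1
    exact h1
  -- `p ∤ [E₁ : K]`
  have hpE : ¬ p ∣ Module.finrank ↥K ↥(fixedField N₁) := fun h => by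
    have h1 := Module.finrank_mul_finrank ↥K ↥(fixedField N₁) L
    have h2 := Module.finrank_mul_finrank ℚ ↥K L
    exact hp (h.trans ((Dvd.intro _ h1).trans (Dvd.intro_left _ h2)))
  -- handing a fixed field of `Gal(E₁/K)` back as a `ℚ`-subfield of `L`
  have transfer : ∀ (S' : Subgroup (↥(fixedField N₁) ≃ₐ[↥K] ↥(fixedField N₁))) (S : Subgroup (L ≃ₐ[ℚ] L)),
      (∀ a : ↥(fixedField N₁), (∀ f ∈ S', f a = a) ↔ ∀ f ∈ S, f (a : L) = (a : L)) →
      (∀ l : L, (∀ f ∈ S, f l = l) → ∀ n ∈ N, n l = l) →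
      (∀ κE : ZpExtension ↥(fixedField S) p, κE.IsCyclotomic → ClassicalMuVanishes κE) →
      ∀ κE : ZpExtension ↥(fixedField S') p, κE.IsCyclotomic → ClassicalMuVanishes κE := by
    intro S' S h1 h2 hμ
    refine forall_classicalMuVanishes_fixedField_of_mem_iff hp K N₁ S' S (fun a => ?_) (fun l hl => ?_) hμ
    · rw [IntermediateField.mem_fixedField_iff, IntermediateField.mem_fixedField_iff]; exact h1 a
    · rw [IntermediateField.mem_fixedField_iff] at hl; exact (hmemE l).mpr (h2 l hl)
  have hN_of : ∀ a : ↥(fixedField N₁), ∀ n ∈ N, n (a : L) = (a : L) := fun a => (hmemE _).mp a.2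
  -- the four fixed fields of the Klein four `{1, z, b, zb}` of `Gal(E₁/K)`
  have hμZ : ∀ κE : ZpExtension ↥(fixedField (Subgroup.zpowers z)) p, κE.IsCyclotomic → ClassicalMuVanishes κE := by
    refine transfer _ (N ⊔ Subgroup.zpowers x) (fun a => ?_) (fun l hl n hn => hl n (Subgroup.mem_sup_left hn)) hμX
    rw [forall_mem_zpowers_apply_eq_iff, forall_mem_sup_apply_eq_iff, forall_mem_zpowers_apply_eq_iff, ← hzL,
      Subtype.ext_iff]
    exact ⟨fun h => ⟨hN_of a, h⟩, fun h => h.2⟩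
  have hμB : ∀ κE : ZpExtension ↥(fixedField (Subgroup.zpowers b)) p, κE.IsCyclotomic → ClassicalMuVanishes κE := by
    refine transfer _ (N ⊔ Subgroup.zpowers y) (fun a => ?_) (fun l hl n hn => hl n (Subgroup.mem_sup_left hn)) hμY
    rw [forall_mem_zpowers_apply_eq_iff, forall_mem_sup_apply_eq_iff, forall_mem_zpowers_apply_eq_iff, ← hbL,
      Subtype.ext_iff]
    exact ⟨fun h => ⟨hN_of a, h⟩, fun h => h.2⟩
  have hμZB : ∀ κE : ZpExtension ↥(fixedField (Subgroup.zpowers (z * b))) p,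
      κE.IsCyclotomic → ClassicalMuVanishes κE := by
    refine transfer _ (N ⊔ Subgroup.zpowers (x * y)) (fun a => ?_) (fun l hl n hn => hl n (Subgroup.mem_sup_left hn))
      hμXY
    rw [forall_mem_zpowers_apply_eq_iff, forall_mem_sup_apply_eq_iff, forall_mem_zpowers_apply_eq_iff,
      AlgEquiv.mul_apply, AlgEquiv.mul_apply, Subtype.ext_iff, hzL, hbL]
    exact ⟨fun h => ⟨hN_of a, h⟩, fun h => h.2⟩
  have hμC' : ∀ κE : ZpExtension ↥(fixedField (Subgroup.closure {z, b})) p,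
      κE.IsCyclotomic → ClassicalMuVanishes κE := by
    refine transfer _ (N ⊔ Subgroup.zpowers x ⊔ Subgroup.zpowers y) (fun a => ?_)
      (fun l hl n hn => hl n (Subgroup.mem_sup_left (Subgroup.mem_sup_left hn))) hμC
    rw [forall_mem_closure_pair_apply_eq_iff, forall_mem_sup_apply_eq_iff, forall_mem_sup_apply_eq_iff,
      forall_mem_zpowers_apply_eq_iff, forall_mem_zpowers_apply_eq_iff, ← hzL, ← hbL, Subtype.ext_iff, Subtype.ext_iff]
    exact ⟨fun h => ⟨⟨hN_of a, h.1⟩, h.2⟩, fun h => ⟨h.1.2, h.2⟩⟩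
  -- Kuroda over `K` for `E₁ = L^N`, then back to `ℚ`
  have key := classicalMuVanishes_of_isCyclotomic_of_biquadratic (F := ↥K) hp2 ↥(fixedField N₁) hpE hzz hbb hzb hμZ hμB hμZB
    hμC'
  -- `E₁ ≅ L^N` as `ℚ`-algebras
  exact forall_classicalMuVanishes_of_mem_fixedField_iff hp K N₁ (fixedField N)
    (fun l => by rw [hmemE, IntermediateField.mem_fixedField_iff]) key κN hκN

end Literature.NumberTheory.IwasawaTheory

end
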